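import Literature.Probability.LatticeModels.KCModifiedHMBarriers
import Literature.Probability.LatticeModels.KCBoundarySmallness
import Literature.Probability.LatticeModels.BoundaryPoleGreenBounds
import HarnessLib

/-!
# The sign condition at the boundary: the lattice inequality of Chelkak–Smirnov's Remark 6.3

Topic `Literature/Probability/LatticeModels`. This file assembles, on `ℤ²` and at one scale, the
argument of Chelkak–Smirnov 2012, proof of Theorem 6.1 (pp. 27–28, eqs. (6.8)–(6.10)) and
Remark 6.3 ("`∂_n H ≤ 0` on `(sp)` in the following sense: there is no point `ζ ∈ (sp)` such that
`H < ϰ` in a neighborhood of `ζ`"), in the Kadanoff–Ceva / boundary-modification rendering of the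
tree (`KCModifiedDirichlet.lean`): a function `u` (the tree's `H_b - c`, sign opposite to the
paper's `H̃ = H - ϰ`) which is modified-subharmonic with zero cemetery on a finite set `D` of
plaquettes and nonnegative at the plaquettes of `D` with a live frozen side satisfies the Green
inequality (★) `kcModHM_green_ineq`; if `u ≤ -η` at the exits of `D` into the MIDDLE part of the
contour and `u ≤ M_b` at the other exits, then (★) gives
`η · (exit flux of V into the middle) ≤ M_b · (exit flux of V at the ends)` (`exitSum_split`), where
`V = kcModHM Λ D g_V` is the harmonic measure with killing of the deep frozen sides. The two fluxes
are then estimated by the lattice potential theory of the tree: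

* the middle flux from BELOW (`half_le_exitSum_mid`): along a flat piece of the contour of `h + 1`
  plaquettes, each exit carries `V ≥ m/(2(h+1))` by the lower quadratic barrier
  (`le_of_superharmonicOn_flatHalfBox`), `m` being a lower bound of `V` on the far sides, obtained
  from the seed bound `κ/8 ≤ V` next to a deep frozen bond (`seed_lower_bound`: comparison with the
  plain harmonic measure, `mul_latticeHM_le_kcModHM`, and the weak Beurling estimate
  `latticeHM_allTouch_compl_sqBox_le`) carried along a Harnack chain (`harnack_chain_lower_bound`);
* the end flux from ABOVE (`endRun_sum_le`): along the straight end run `c₀ + i e_τ`, `i ≤ L`, of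
  the contour issued from a frozen bond, each lateral exit at `c_i` carries
  `V ≤ 4 A φ(i + i/8 + 1) / (i/8 + 2)` by the upper quadratic barrier (`le_of_subharmonicOn_flatHalfBox`)
  and the power decay `end_decay_of_cuts` (`φ(r) = ((r+1)/(R₀+1))^γ`), which sums to
  `(128/γ + 288) A ((L+1)/(R₀+1))^γ` (`sum_rpow_sub_one_le`);

and the final inequality **`kc_sign_condition_ineq`**:
`η κ (c_*/2)^{J+1} / 16 ≤ M_b (128/γ + 288) A ∑_{e} ((L_e+1)/(R₀^e+1))^γ`.
Letting the mesh tend to zero with the geometry fixed (`J`, and `L_e/R₀^e ≍ μ₁/d₀`) and then the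
length `μ₁` of the ends to zero contradicts `η > 0`: this is how the continuum sign condition (the
hypothesis `h2` of `eqOn_domainSpinorSq_of_bvp`) is delivered from the lattice. Everything here is
proved; the hypotheses are purely combinatorial.

## References

* D. Chelkak, S. Smirnov, Invent. Math. 189 (2012) = arXiv:0910.2045: proof of Thm. 6.1
  (pp. 27–28, eqs. (6.8)–(6.10)) and Remark 6.3 [ChelkakSmirnov2012Ising].
* D. Chelkak, C. Hongler, K. Izyurov, Ann. of Math. 181 (2015), §3.3.1 (boundary modification),
  Remark 3.? / proof of Prop. 3.9 (use of the sign condition) [ChelkakHonglerIzyurovAnnals2015].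
* S. Smirnov, Ann. of Math. 172 (2010), Lemma B.2 [Smirnov2010].
-/

noncomputable section

open Finset Set SimpleGraph

namespace Literature.Probability.LatticeModels

open WeakBeurling

/-! ### Lattice bookkeeping -/

/-- `k + 3 = k + 1 + 2` in `Fin 4`. [folklore] -/
theorem fin4_add_three_eq (k : Fin 4) : k + 3 = k + 1 + 2 := by revert k; decide

/-- The four residues of `j - k` in `Fin 4`. [folklore] -/
theorem fin4_eq_add_cases (j k : Fin 4) : j = k ∨ j = k + 3 ∨ j = k + 1 ∨ j = k + 2 := by
  revert j k; decide

/-- The plaquette across the side `m + 3` of `g + e_m` is `g`. [folklore] -/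
theorem sideNbr_add_cornerUnit (g : Site 2) (m : Fin 4) : sideNbr (g + cornerUnit m) (m + 3) = g := by
  rw [sideNbr, fin4_add_three_add_three, cornerUnit_add_two]; abel

/-- If `sideNbr f j = g` then `f = g + e_{j+1}`. [folklore] -/
theorem eq_add_cornerUnit_of_sideNbr_eq {f g : Site 2} {j : Fin 4} (h : sideNbr f j = g) : f = g + cornerUnit (j + 1) := by
  rw [← h, sideNbr, fin4_add_three_eq j, cornerUnit_add_two]; abel

/-- A point in frame coordinates: `z = z₀ + b e_k + t e_{k+1}`. [folklore] -/
theorem eq_of_frame (k : Fin 4) (z₀ z : Site 2) :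
    z = z₀ + nCoord k z₀ z • cornerUnit k + tCoord k z₀ z • cornerUnit (k + 1) := by
  ext i
  fin_cases k <;> fin_cases i <;> simp [nCoord, tCoord, cornerUnit]

/-- Multiples of a unit vector stay in the box of their length. [folklore] -/
theorem add_zsmul_cornerUnit_mem_sqBox (c₀ : Site 2) (n : ℤ) (k : Fin 4) {R : ℤ} (hR : |n| ≤ R) :
    c₀ + n • cornerUnit k ∈ sqBox c₀ R := by
  rw [mem_sqBox]
  have h0 : 0 ≤ R := (abs_nonneg n).trans hR
  fin_cases k <;> simp [cornerUnit, abs_le] <;> rw [abs_le] at hR <;> omega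

/-- Triangle inequality for boxes. [folklore] -/
theorem mem_sqBox_of_mem_sqBox {c z w : Site 2} {r r' : ℤ} (hz : z ∈ sqBox c r) (hw : w ∈ sqBox z r') :
    w ∈ sqBox c (r + r') := by
  rw [mem_sqBox, abs_le, abs_le] at hz hw ⊢; omega

/-! ### Exit sums and the split of the Green inequality -/

/-- **The exit flux** of the weight `w` through the touching exits of `D` whose target satisfies
`P`: `∑_{f ∈ D} ∑_{j : side j of f touches, sideNbr f j ∉ D, P (sideNbr f j)} w f`. [cite: ChelkakSmirnov2012Ising, proof of Thm. 6.1, eq. (6.9)] -/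
def exitSum (Λ D : Finset (Site 2)) (P : Site 2 → Prop) [DecidablePred P] (w : Site 2 → ℝ) : ℝ :=
  ∑ f ∈ D, ∑ j : Fin 4, if SideTouch Λ f j ∧ sideNbr f j ∉ D ∧ P (sideNbr f j) then w f else 0

/-- The exit flux of a nonnegative weight is nonnegative. [folklore] -/
theorem exitSum_nonneg (Λ D : Finset (Site 2)) (P : Site 2 → Prop) [DecidablePred P] {w : Site 2 → ℝ}
    (hw : ∀ x, 0 ≤ w x) : 0 ≤ exitSum Λ D P w :=
  Finset.sum_nonneg fun f _ => Finset.sum_nonneg fun j _ => by split_ifs <;> [exact hw f; exact le_rfl]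

/-- **The split of the Green inequality (★).** Let `u` be modified-subharmonic with zero cemetery on
`D`, with `u f · g_V ≥ 0` at the frozen corners of the plaquettes of `D` (i.e. `u ≥ 0` wherever the
cemetery is live), `u ≤ -η` at the exit targets in `Mid` and `u ≤ M_b` (`M_b ≥ 0`) at the other exit
targets. Then `η · (flux of V into Mid) ≤ M_b · (flux of V elsewhere)` for `V = kcModHM Λ D g_V`
(Chelkak–Smirnov: "(6.9) ... `≥ 0`; on most of `C^δ` we have `H̃ < 0` ..., which gives a
contradiction" once the ends are controlled). [cite: ChelkakSmirnov2012Ising, proof of Thm. 6.1, eq. (6.9)] -/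
theorem exitSum_split (Λ D : Finset (Site 2)) (gV u : Site 2 → ℝ) (hgV : ∀ x, 0 ≤ gV x)
    (hsub : ∀ f ∈ D, 0 ≤ kcModLaplacian Λ (fun _ => 0) u f)
    (hu0 : ∀ f ∈ D, ∀ j : Fin 4, ¬ SideTouch Λ f j → 0 ≤ u f * gV (f + cornerOff j))
    (Mid : Site 2 → Prop) [DecidablePred Mid] {η Mb : ℝ}
    (hMid : ∀ f ∈ D, ∀ j : Fin 4, SideTouch Λ f j → sideNbr f j ∉ D → Mid (sideNbr f j) → u (sideNbr f j) ≤ -η)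
    (hRest : ∀ f ∈ D, ∀ j : Fin 4, SideTouch Λ f j → sideNbr f j ∉ D → ¬ Mid (sideNbr f j) → u (sideNbr f j) ≤ Mb) :
    η * exitSum Λ D Mid (kcModHM Λ D gV) ≤ Mb * exitSum Λ D (fun g => ¬ Mid g) (kcModHM Λ D gV) := by
  classical
  set V := kcModHM Λ D gV with hV
  have hV0 : ∀ x, 0 ≤ V x := kcModHM_nonneg Λ D hgV
  have hG := kcModHM_green_ineq Λ D gV u hgV hsub
  -- the left-hand side of (★) is nonnegative
  have hL : 0 ≤ modKappa * ∑ f ∈ D, u f * ∑ j : Fin 4, (if SideTouch Λ f j then 0 else gV (f + cornerOff j)) := by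
    refine mul_nonneg modKappa_pos.le (Finset.sum_nonneg fun f hf => ?_)
    rw [Finset.mul_sum]
    refine Finset.sum_nonneg fun j _ => ?_
    split_ifs with h
    · simp
    · exact hu0 f hf j h
  -- bound each exit term
  have hterm : ∀ f ∈ D, ∀ j : Fin 4,
      (if SideTouch Λ f j ∧ sideNbr f j ∉ D then V f * u (sideNbr f j) else 0) ≤
        (-η) * (if SideTouch Λ f j ∧ sideNbr f j ∉ D ∧ Mid (sideNbr f j) then V f else 0) +
          Mb * (if SideTouch Λ f j ∧ sideNbr f j ∉ D ∧ ¬ Mid (sideNbr f j) then V f else 0) := by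
    intro f hf j
    by_cases h1 : SideTouch Λ f j ∧ sideNbr f j ∉ D
    · by_cases h2 : Mid (sideNbr f j)
      · rw [if_pos h1, if_pos ⟨h1.1, h1.2, h2⟩, if_neg (fun h => h.2.2 h2), mul_zero, add_zero]
        have := hMid f hf j h1.1 h1.2 h2
        nlinarith [hV0 f]
      · rw [if_pos h1, if_neg (fun h => h2 h.2.2), if_pos ⟨h1.1, h1.2, h2⟩, mul_zero, zero_add]
        have := hRest f hf j h1.1 h1.2 h2
        nlinarith [hV0 f]
    · rw [if_neg h1, if_neg (fun h => h1 ⟨h.1, h.2.1⟩), if_neg (fun h => h1 ⟨h.1, h.2.1⟩)]; simp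
  have hsum : ∑ f ∈ D, ∑ j : Fin 4, (if SideTouch Λ f j ∧ sideNbr f j ∉ D then V f * u (sideNbr f j) else 0) ≤
      (-η) * exitSum Λ D Mid V + Mb * exitSum Λ D (fun g => ¬ Mid g) V := by
    simp only [exitSum, Finset.mul_sum, ← Finset.sum_add_distrib]
    exact Finset.sum_le_sum fun f hf => Finset.sum_le_sum fun j _ => hterm f hf j
  linarith

/-- `sideNbr f j = g ↔ f = g + e_{j+1}`. [folklore] -/
theorem sideNbr_eq_iff (f g : Site 2) (j : Fin 4) : sideNbr f j = g ↔ f = g + cornerUnit (j + 1) := by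
  refine ⟨eq_add_cornerUnit_of_sideNbr_eq, fun h => ?_⟩
  rw [h]
  have := sideNbr_add_cornerUnit g (j + 1)
  rwa [fin4_add_one_add_three] at this

/-- **The non-middle flux is carried by the end runs.** If every exit target outside `Mid` is one of
the plaquettes `c₀^e + i e_{τ_e}`, `i ≤ L_e`, of finitely many runs, then the flux of a nonnegative
weight elsewhere is at most the sum over the runs of `∑_{i ≤ L_e} ∑_m [c_i^e + e_m ∈ D] w (c_i^e + e_m)`. [folklore] -/
theorem exitSum_rest_le_runs (Λ D : Finset (Site 2)) (Mid : Site 2 → Prop) [DecidablePred Mid] {w : Site 2 → ℝ}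
    (hw : ∀ x, 0 ≤ w x) {ι : Type*} (E : Finset ι) (c : ι → ℕ → Site 2) (L : ι → ℕ)
    (hruns : ∀ f ∈ D, ∀ j : Fin 4, SideTouch Λ f j → sideNbr f j ∉ D → ¬ Mid (sideNbr f j) →
      ∃ e ∈ E, ∃ i : ℕ, i ≤ L e ∧ sideNbr f j = c e i) :
    exitSum Λ D (fun g => ¬ Mid g) w ≤
      ∑ e ∈ E, ∑ i ∈ Finset.range (L e + 1), ∑ m : Fin 4, (if c e i + cornerUnit m ∈ D then w (c e i + cornerUnit m) else 0) := by
  classical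
  -- Step 1: per exit, the indicator is dominated by the run indicators
  have h1 : ∀ f ∈ D, ∀ j : Fin 4,
      (if SideTouch Λ f j ∧ sideNbr f j ∉ D ∧ ¬ Mid (sideNbr f j) then w f else 0) ≤
        ∑ e ∈ E, ∑ i ∈ Finset.range (L e + 1), (if f = c e i + cornerUnit (j + 1) then w f else 0) := by
    intro f hf j
    have hnn : ∀ e ∈ E, 0 ≤ ∑ i ∈ Finset.range (L e + 1), (if f = c e i + cornerUnit (j + 1) then w f else 0) :=
      fun e _ => Finset.sum_nonneg fun i _ => by split_ifs <;> [exact hw f; exact le_rfl]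
    split_ifs with hc
    · obtain ⟨e, he, i, hi, heq⟩ := hruns f hf j hc.1 hc.2.1 hc.2.2
      refine le_trans ?_ (Finset.single_le_sum hnn he)
      have hnn' : ∀ i' ∈ Finset.range (L e + 1), 0 ≤ (if f = c e i' + cornerUnit (j + 1) then w f else 0) :=
        fun i' _ => by split_ifs <;> [exact hw f; exact le_rfl]
      refine le_trans ?_ (Finset.single_le_sum hnn' (Finset.mem_range.2 (Nat.lt_succ_of_le hi)))
      rw [if_pos ((sideNbr_eq_iff f _ j).1 heq)]
    · exact Finset.sum_nonneg hnn
  -- Step 2: sum over `f ∈ D`, `j`, and reorder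
  calc exitSum Λ D (fun g => ¬ Mid g) w
      ≤ ∑ f ∈ D, ∑ j : Fin 4, ∑ e ∈ E, ∑ i ∈ Finset.range (L e + 1), (if f = c e i + cornerUnit (j + 1) then w f else 0) :=
        Finset.sum_le_sum fun f hf => Finset.sum_le_sum fun j _ => h1 f hf j
    _ = ∑ f ∈ D, ∑ m : Fin 4, ∑ e ∈ E, ∑ i ∈ Finset.range (L e + 1), (if f = c e i + cornerUnit m then w f else 0) := by
        refine Finset.sum_congr rfl fun f _ => ?_
        exact Fintype.sum_equiv (Equiv.addRight (1 : Fin 4))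
          (fun j => ∑ e ∈ E, ∑ i ∈ Finset.range (L e + 1), (if f = c e i + cornerUnit (j + 1) then w f else 0))
          (fun m => ∑ e ∈ E, ∑ i ∈ Finset.range (L e + 1), (if f = c e i + cornerUnit m then w f else 0)) fun j => rfl
    _ = ∑ e ∈ E, ∑ i ∈ Finset.range (L e + 1), ∑ m : Fin 4, ∑ f ∈ D, (if f = c e i + cornerUnit m then w f else 0) := by
        simp only [Finset.sum_comm (s := (Finset.univ : Finset (Fin 4)))]
        simp only [Finset.sum_comm (s := D)]
    _ = _ := by
        refine Finset.sum_congr rfl fun e _ => Finset.sum_congr rfl fun i _ => Finset.sum_congr rfl fun m _ => ?_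
        rw [Finset.sum_ite_eq' D]

/-! ### Straight runs of plaquettes -/

/-- The `n`-th plaquette of the straight run from `c₀` in direction `e_k`. [folklore] -/
def runPt (c₀ : Site 2) (k : Fin 4) (n : ℤ) : Site 2 := c₀ + n • cornerUnit k

/-- Coordinates of run plaquettes. [folklore] -/
@[simp] theorem runPt_apply (c₀ : Site 2) (k : Fin 4) (n : ℤ) (l : Fin 2) : runPt c₀ k n l = c₀ l + n * cornerUnit k l := by
  simp [runPt, Pi.add_apply]

/-- `runPt c₀ k 0 = c₀`. [folklore] -/
@[simp] theorem runPt_zero (c₀ : Site 2) (k : Fin 4) : runPt c₀ k 0 = c₀ := by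
  ext l; simp

/-- One step along the run. [folklore] -/
theorem runPt_add_cornerUnit (c₀ : Site 2) (k : Fin 4) (n : ℤ) : runPt c₀ k n + cornerUnit k = runPt c₀ k (n + 1) := by
  ext l; simp [Pi.add_apply]; ring

/-- One step back along the run. [folklore] -/
theorem runPt_add_cornerUnit_add_two (c₀ : Site 2) (k : Fin 4) (n : ℤ) :
    runPt c₀ k n + cornerUnit (k + 2) = runPt c₀ k (n - 1) := by
  rw [cornerUnit_add_two]; ext l; simp [Pi.add_apply]; ring

/-- A tangential multiple added to a run point. [folklore] -/
theorem runPt_add_zsmul (c₀ : Site 2) (k : Fin 4) (n t : ℤ) : runPt c₀ k n + t • cornerUnit k = runPt c₀ k (n + t) := by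
  ext l; simp [Pi.add_apply]; ring

/-- A negative tangential multiple added to a run point. [folklore] -/
theorem runPt_add_zsmul_add_two (c₀ : Site 2) (k : Fin 4) (n t : ℤ) :
    runPt c₀ k n + t • cornerUnit (k + 2) = runPt c₀ k (n - t) := by
  rw [cornerUnit_add_two]; ext l; simp [Pi.add_apply]; ring

/-- Run plaquettes stay in the box of their index. [folklore] -/
theorem runPt_mem_sqBox (c₀ : Site 2) (k : Fin 4) (n : ℤ) {R : ℤ} (hR : |n| ≤ R) : runPt c₀ k n ∈ sqBox c₀ R :=
  add_zsmul_cornerUnit_mem_sqBox c₀ n k hR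

/-- Frame coordinates (normal `e_m`) of a point `runPt c₀ k n + b e_m + t e_{m+1}`. [folklore] -/
theorem frame_runPt (m : Fin 4) (z₀ : Site 2) (b t : ℤ) :
    nCoord m z₀ (z₀ + b • cornerUnit m + t • cornerUnit (m + 1)) = b ∧
      tCoord m z₀ (z₀ + b • cornerUnit m + t • cornerUnit (m + 1)) = t := by
  fin_cases m <;> simp [nCoord, tCoord, Pi.add_apply]

/-! ### The middle flux from below -/

/-- **The middle flux from below.** Along a flat piece `zm + t e_{k+1}`, `t ≤ h`, of the contour
(in `Mid`, off `D`) whose inner neighbours `· + e_k` lie in `D` with the side towards the contour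
touching, with the half-boxes `{1 ≤ b ≤ h, |t'| ≤ 2h+1}` over each of its points consisting of
all-touch plaquettes of `D`, and with `V = kcModHM Λ D g_V ≥ m` on their far sides: the flux of `V`
into `Mid` is at least `(h+1) · m/(2(h+1)) = m/2` (Chelkak–Smirnov's "(6.9′)":
`∑_{(q̃ r̃)} V(u_int) H̃ tan θ ≤ -const < 0`). [cite: ChelkakSmirnov2012Ising, proof of Thm. 6.1, eq. (6.9′)] -/
theorem half_le_exitSum_mid (Λ D : Finset (Site 2)) (Mid : Site 2 → Prop) [DecidablePred Mid]
    {gV : Site 2 → ℝ} (hg0 : ∀ x, 0 ≤ gV x) (k : Fin 4) (zm : Site 2) {h : ℕ} (hh : 1 ≤ h) {m : ℝ} (hm : 0 ≤ m)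
    (hrun : ∀ t : ℕ, t ≤ h → Mid (runPt zm (k + 1) t) ∧ runPt zm (k + 1) t ∉ D ∧
      runPt zm (k + 1) t + cornerUnit k ∈ D ∧ SideTouch Λ (runPt zm (k + 1) t + cornerUnit k) (k + 3))
    (hbox : ∀ t : ℕ, t ≤ h → ∀ z ∈ flatHalfBox k (runPt zm (k + 1) t) h (2 * h + 1), z ∈ D ∧ ∀ j : Fin 4, SideTouch Λ z j)
    (hfar : ∀ t : ℕ, t ≤ h → ∀ z, nCoord k (runPt zm (k + 1) t) z = h + 1 →
      |tCoord k (runPt zm (k + 1) t) z| ≤ 2 * h + 1 → m ≤ kcModHM Λ D gV z) :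
    m / 2 ≤ exitSum Λ D Mid (kcModHM Λ D gV) := by
  classical
  set V := kcModHM Λ D gV with hV
  have hV0 : ∀ x, 0 ≤ V x := kcModHM_nonneg Λ D hg0
  set F : Finset (Site 2) := (Finset.range (h + 1)).image fun t : ℕ => runPt zm (k + 1) t + cornerUnit k with hF
  have hFD : F ⊆ D := by
    intro f hf
    rw [hF, Finset.mem_image] at hf
    obtain ⟨t, ht, rfl⟩ := hf
    exact (hrun t (Nat.lt_succ_iff.1 (Finset.mem_range.1 ht))).2.2.1
  have hinj : Set.InjOn (fun t : ℕ => runPt zm (k + 1) t + cornerUnit k) ↑(Finset.range (h + 1)) := by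
    intro t _ t' _ heq
    have e1 : ∀ s : ℕ, tCoord k zm (runPt zm (k + 1) s + cornerUnit k) = s := by
      intro s
      have := (frame_runPt k zm 1 s).2
      rw [one_zsmul] at this
      rw [runPt, add_right_comm]
      exact this
    have := congrArg (tCoord k zm) heq
    simp only [e1] at this
    exact_mod_cast this
  -- each exit of the flat piece carries `V ≥ m / (2(h+1))`
  have hterm : ∀ t : ℕ, t ≤ h → m / (2 * ((h : ℝ) + 1)) ≤ V (runPt zm (k + 1) t + cornerUnit k) := by
    intro t ht
    have hsup : IsLatticeSuperharmonicOn V (flatHalfBox k (runPt zm (k + 1) t) h (2 * h + 1)) :=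
      (isLatticeHarmonicOn_kcModHM Λ D gV (hbox t ht)).superharmonicOn
    exact le_of_superharmonicOn_flatHalfBox k _ hh hm hsup hV0 (hfar t ht)
  -- the flux dominates the sum over the flat piece
  have hnn : ∀ f ∈ D, 0 ≤ ∑ j : Fin 4, (if SideTouch Λ f j ∧ sideNbr f j ∉ D ∧ Mid (sideNbr f j) then V f else 0) :=
    fun f _ => Finset.sum_nonneg fun j _ => by split_ifs <;> [exact hV0 f; exact le_rfl]
  calc m / 2 = ∑ _t ∈ Finset.range (h + 1), m / (2 * ((h : ℝ) + 1)) := by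
        rw [Finset.sum_const, Finset.card_range, nsmul_eq_mul]; push_cast; field_simp
    _ ≤ ∑ t ∈ Finset.range (h + 1), V (runPt zm (k + 1) t + cornerUnit k) :=
        Finset.sum_le_sum fun t ht => hterm t (Nat.lt_succ_iff.1 (Finset.mem_range.1 ht))
    _ = ∑ f ∈ F, V f := by rw [hF, Finset.sum_image hinj]
    _ ≤ ∑ f ∈ F, ∑ j : Fin 4, (if SideTouch Λ f j ∧ sideNbr f j ∉ D ∧ Mid (sideNbr f j) then V f else 0) := by
        refine Finset.sum_le_sum fun f hf => ?_
        rw [hF, Finset.mem_image] at hf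
        obtain ⟨t, ht, rfl⟩ := hf
        obtain ⟨hmid, hnD, _, hst⟩ := hrun t (Nat.lt_succ_iff.1 (Finset.mem_range.1 ht))
        have hnbr : sideNbr (runPt zm (k + 1) t + cornerUnit k) (k + 3) = runPt zm (k + 1) t := sideNbr_add_cornerUnit _ k
        have hnn' : ∀ j ∈ (Finset.univ : Finset (Fin 4)),
            0 ≤ (if SideTouch Λ (runPt zm (k + 1) ↑t + cornerUnit k) j ∧ sideNbr (runPt zm (k + 1) ↑t + cornerUnit k) j ∉ D ∧
              Mid (sideNbr (runPt zm (k + 1) ↑t + cornerUnit k) j) then V (runPt zm (k + 1) ↑t + cornerUnit k) else 0) :=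
          fun j _ => by split_ifs <;> [exact hV0 _; exact le_rfl]
        refine le_trans ?_ (Finset.single_le_sum hnn' (Finset.mem_univ (k + 3)))
        rw [if_pos ⟨hst, by rw [hnbr]; exact hnD, by rw [hnbr]; exact hmid⟩]
    _ ≤ exitSum Λ D Mid V := Finset.sum_le_sum_of_subset_of_nonneg hFD fun f hf _ => hnn f hf

/-! ### The seed: `V ≥ κ/8` next to a deep frozen bond -/

/-- All-touch plaquettes of `D` are the points of `allTouchPlaquettes Λ ∖ Dᶜ`. [folklore] -/
theorem mem_allTouch_diff_iff {Λ D : Finset (Site 2)} {f : Site 2} :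
    f ∈ ((↑(allTouchPlaquettes Λ) : Set (Site 2)) \ (↑D : Set (Site 2))ᶜ) ↔ f ∈ D ∧ ∀ j : Fin 4, SideTouch Λ f j := by
  rw [Set.mem_sdiff, Set.notMem_compl_iff, Finset.mem_coe, Finset.mem_coe, mem_allTouchPlaquettes, mem_touchPlaquettes_iff_corner]
  have hside : ∀ j : Fin 4, (f + cornerOff j ∈ Λ ∨ f + cornerOff (j + 1) ∈ Λ) ↔ SideTouch Λ f j := by
    intro j
    rw [SideTouch, ← add_cornerUnit_add_cornerOff, add_right_comm]
  constructor
  · rintro ⟨⟨_, hall⟩, hfD⟩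
    exact ⟨hfD, fun j => (hside j).1 (hall j)⟩
  · rintro ⟨hfD, hall⟩
    refine ⟨⟨?_, fun j => (hside j).2 (hall j)⟩, hfD⟩
    rcases hall 0 with h0 | h0
    · exact ⟨0, h0⟩
    · refine ⟨0 + 1, ?_⟩
      rw [← add_cornerUnit_add_cornerOff, add_right_comm]; exact h0

/-- **The seed bound** (`B_*` step of the sign-condition argument): let `(a, a + e_{k₀})` be a
frozen bond and `ĝ = faceAt a j₀` a plaquette at it; suppose the touching steps from all-touch
plaquettes of `D` stay in `D` inside `sqBox ĝ R`, the frozen corners of the plaquettes of `D` inside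
`sqBox ĝ R` carry cemetery value `1`, and `2 C ((ρ+1)/(R+1))^β ≤ 1`. Then `κ/8 ≤ kcModHM Λ D g_V` at
every all-touch plaquette of `D` in `sqBox ĝ ρ`: `V ≥ (κ/4) ω_T(·, E)` (`mul_latticeHM_le_kcModHM`)
and `ω_T(·, E) ≥ 1 - ω_T(·, (sqBox ĝ R)ᶜ) ≥ 1/2` by the weak Beurling estimate with the frozen cut
(`latticeHM_allTouch_compl_sqBox_le`). [cite: ChelkakSmirnov2012Ising, proof of Thm. 6.1 (V^δ ⇉ ω > 0); Smirnov2010, Lemma B.2] -/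
theorem seed_lower_bound {Λ : Finset (Site 2)} (hΛ : HoleFree (↑Λ : Set (Site 2))) (D : Finset (Site 2))
    {gV : Site 2 → ℝ} (hg0 : ∀ x, 0 ≤ gV x)
    {a : Site 2} {k₀ j₀ : Fin 4} (ha : a ∉ Λ) (hk₀ : a + cornerUnit k₀ ∉ Λ) (hj₀ : j₀ = k₀ ∨ j₀ = k₀ + 3)
    {ρ R : ℕ} (hρR : 2 * beurlingConst * (((ρ : ℝ) + 1) / ((R : ℝ) + 1)) ^ beurlingExp ≤ 1)
    (hclosed : ∀ v ∈ D, (∀ j : Fin 4, SideTouch Λ v j) → ∀ m : Fin 4, v + cornerUnit m ∈ sqBox (faceAt a j₀) R → v + cornerUnit m ∈ D)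
    (hE : ∀ w ∈ D, w ∈ sqBox (faceAt a j₀) R → ∀ j : Fin 4, ¬ SideTouch Λ w j → gV (w + cornerOff j) = 1)
    {c : Site 2} (hcD : c ∈ D) (hcT : ∀ j : Fin 4, SideTouch Λ c j) (hc : c ∈ sqBox (faceAt a j₀) ρ) :
    modKappa / 8 ≤ kcModHM Λ D gV c := by
  classical
  set T : Set (Site 2) := (↑(allTouchPlaquettes Λ) : Set (Site 2)) \ (↑D : Set (Site 2))ᶜ with hTdef
  have hTfin : T.Finite := (Finset.finite_toSet _).subset fun _ hx => hx.1
  have hTsub : ∀ f ∈ T, f ∈ D ∧ ∀ j : Fin 4, SideTouch Λ f j := fun f hf => mem_allTouch_diff_iff.1 hf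
  have hcT' : c ∈ T := mem_allTouch_diff_iff.2 ⟨hcD, hcT⟩
  set E : Set (Site 2) := {g | g ∈ D ∧ ∃ j : Fin 4, ¬ SideTouch Λ g j ∧ gV (g + cornerOff j) = 1} with hEdef
  have h1 := mul_latticeHM_le_kcModHM Λ D hg0 hTfin hTsub (E := E) (fun g hg => hg) c hcT'
  -- `ω_T(c, E) ≥ 1 - ω_T(c, (sqBox ĝ R)ᶜ)`
  set B : Set (Site 2) := (sqBox (faceAt a j₀) R)ᶜ with hBdef
  have hF : ∀ v ∈ T, 1 ≤ latticeHM T E v + latticeHM T B v := by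
    have hharm : IsLatticeHarmonicOn (latticeHM T E + latticeHM T B) T := fun v hv => by
      rw [latticeLaplacian_add, latticeHM_harmonicOn hTfin E v hv, latticeHM_harmonicOn hTfin B v hv, add_zero]
    have key := hharm.superharmonicOn.ge_of_forall_boundary_ge hTfin (M := 1) ?_
    · intro v hv; have := key v hv; simpa using this
    intro w hw
    rw [Pi.add_apply]
    obtain ⟨hwT, v, hv, m, rfl⟩ := hw
    have h0E := (latticeHM_mem_Icc hTfin E (v + cornerUnit m)).1
    have h0B := (latticeHM_mem_Icc hTfin B (v + cornerUnit m)).1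
    by_cases hbox : v + cornerUnit m ∈ sqBox (faceAt a j₀) R
    · obtain ⟨hvD, hvall⟩ := hTsub v hv
      have hwD := hclosed v hvD hvall m hbox
      have hnall : ∃ j : Fin 4, ¬ SideTouch Λ (v + cornerUnit m) j := by
        by_contra hall
        push Not at hall
        exact hwT (mem_allTouch_diff_iff.2 ⟨hwD, hall⟩)
      obtain ⟨j, hj⟩ := hnall
      have hwE : v + cornerUnit m ∈ E := ⟨hwD, j, hj, hE _ hwD hbox j hj⟩
      rw [latticeHM_of_not_mem_of_mem hTfin hwT hwE]
      linarith
    · rw [latticeHM_of_not_mem_of_mem hTfin hwT (Set.mem_compl hbox)]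
      linarith
  have hWB : latticeHM T B c ≤ beurlingConst * (((ρ : ℝ) + 1) / ((R : ℝ) + 1)) ^ beurlingExp :=
    latticeHM_allTouch_compl_sqBox_le hΛ ((↑D : Set (Site 2))ᶜ) ha hk₀ hj₀ R hcT' hc
  have h2 : 1 / 2 ≤ latticeHM T E c := by linarith [hF c hcT']
  have hk := modKappa_pos
  calc modKappa / 8 = modKappa / 4 * (1 / 2) := by ring
    _ ≤ modKappa / 4 * latticeHM T E c := mul_le_mul_of_nonneg_left h2 (by linarith)
    _ ≤ kcModHM Λ D gV c := h1

/-! ### Harnack chains -/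

/-- **Lower bound along a Harnack chain**: if `V ≥ 0` is lattice-harmonic on the big boxes
`mW (c_j) k` along centres `c_0, …, c_J` with `c_{j+1} ∈ mB (c_j) k`, then
`V ≥ (c_*/2)^{J+1} V(c_0)` on `⋃_j mB (c_j) k`. [cite: LawlerSchrammWerner2004, Lemma 5.2] -/
theorem harnack_chain_lower_bound {V : Site 2 → ℝ} (hnn : ∀ w, 0 ≤ V w) {kH : ℕ} (hk : 0 < kH) (cH : ℕ → Site 2) (J : ℕ)
    (hharm : ∀ j, j ≤ J → IsLatticeHarmonicOn V (mW (cH j) kH)) (hstep : ∀ j, j < J → cH (j + 1) ∈ mB (cH j) kH)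
    {z : Site 2} (hz : ∃ j, j ≤ J ∧ z ∈ mB (cH j) kH) :
    (maneuverConst / 2) ^ (J + 1) * V (cH 0) ≤ V z := by
  obtain ⟨j, hj, hzj⟩ := hz
  have h1 := harnack_chain hnn hk cH j (fun i hi => hharm i (hi.trans hj)) (fun i hi => hstep i (by omega))
  have h2 := harnack_box (cH j) hk (hharm j hj) hnn hzj
  have hc0 : 0 ≤ maneuverConst / 2 := by linarith [maneuverConst_pos]
  have hc1 : maneuverConst / 2 ≤ 1 := by linarith [maneuverConst_le_one]
  calc (maneuverConst / 2) ^ (J + 1) * V (cH 0) ≤ (maneuverConst / 2) ^ (j + 1) * V (cH 0) :=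
        mul_le_mul_of_nonneg_right (pow_le_pow_of_le_one hc0 hc1 (by omega)) (hnn _)
    _ = maneuverConst / 2 * ((maneuverConst / 2) ^ j * V (cH 0)) := by rw [pow_succ]; ring
    _ ≤ maneuverConst / 2 * V (cH j) := mul_le_mul_of_nonneg_left h1 hc0
    _ ≤ V z := h2

/-! ### The end flux from above -/

/-- Cuts from a plaquette at a frozen bond of a hole-free `Λ`: for every `R`, a plaquette walk from
`faceAt a j₀` leaving `sqBox (faceAt a j₀) R` through plaquettes that are not all-touch. [cite: Smirnov2010, §3] -/
theorem exists_cut_of_holeFree {Λ : Finset (Site 2)} (hΛ : HoleFree (↑Λ : Set (Site 2))) {a : Site 2} {k₀ j₀ : Fin 4}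
    (ha : a ∉ Λ) (hk₀ : a + cornerUnit k₀ ∉ Λ) (hj₀ : j₀ = k₀ ∨ j₀ = k₀ + 3) (D : Finset (Site 2)) (R : ℕ) :
    ∃ (d : Site 2) (q : (zdGraph 2).Walk (faceAt a j₀) d), d ∉ sqBox (faceAt a j₀) R ∧
      ∀ z ∈ q.support, ¬ (z ∈ D ∧ ∀ j : Fin 4, SideTouch Λ z j) := by
  obtain ⟨b, W, hb, hW⟩ := exists_walk_high_of_holeFree hΛ ha (a 1 + R + 2)
  obtain ⟨m, Q, hQ⟩ := exists_plaqWalk_along W hW hk₀ j₀ hj₀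
  refine ⟨faceAt b m, Q, fun hd => ?_, fun z hz hzT => hQ z hz ((mem_allTouch_diff_iff (D := D)).2 hzT).1⟩
  rw [mem_sqBox] at hd
  have h1 : (faceAt b m) 1 = b 1 - (cornerOff m) 1 := by simp [faceAt]
  have h2 : (faceAt a j₀) 1 = a 1 - (cornerOff j₀) 1 := by simp [faceAt]
  have hm : (cornerOff m) 1 = 0 ∨ (cornerOff m) 1 = 1 := by fin_cases m <;> simp [cornerOff]
  have hj : (cornerOff j₀) 1 = 0 ∨ (cornerOff j₀) 1 = 1 := by fin_cases j₀ <;> simp [cornerOff]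
  have := hd.2
  rw [h1, h2, abs_le] at this
  rcases hm with hm | hm <;> rcases hj with hj | hj <;> rw [hm, hj] at this <;> omega

/-- **A plaquette with a frozen corner is at, or next to, a plaquette at a frozen bond** of a
hole-free `Λ` (the frozen corner has a frozen neighbour, and consecutive plaquettes around a site
are side-adjacent). [folklore] -/
theorem exists_bond_plaquette_of_frozen_corner {Λ : Finset (Site 2)} (hΛ : HoleFree (↑Λ : Set (Site 2)))
    {a : Site 2} (ha : a ∉ Λ) (j₁ : Fin 4) :
    ∃ k₀ j₀ : Fin 4, a + cornerUnit k₀ ∉ Λ ∧ (j₀ = k₀ ∨ j₀ = k₀ + 3) ∧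
      (faceAt a j₁ = faceAt a j₀ ∨ (zdGraph 2).Adj (faceAt a j₁) (faceAt a j₀)) := by
  -- a frozen neighbour from hole-freeness
  obtain ⟨g', hg', hpath⟩ := hΛ a ha (a 1 + 1)
  obtain ⟨k₀, hk₀⟩ : ∃ k₀ : Fin 4, a + cornerUnit k₀ ∉ Λ := by
    rcases hpath.cases_head with h | ⟨c, hac, _⟩
    · rw [h] at hg'; omega
    · obtain ⟨k, rfl⟩ := exists_eq_add_cornerUnit hac.1
      exact ⟨k, hac.2.2⟩
  -- the four plaquettes around `a`: `j₁ ∈ {k₀, k₀ + 3}` or `j₁` is next to one of them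
  have hadj : ∀ i : Fin 4, (zdGraph 2).Adj (faceAt a (i + 1)) (faceAt a i) := by
    intro i; rw [faceAt_succ_eq]; exact (zdGraph_adj_add_cornerUnit _ _).symm
  have hadj' : ∀ i : Fin 4, (zdGraph 2).Adj (faceAt a i) (faceAt a (i + 1)) := fun i => (hadj i).symm
  rcases fin4_eq_add_cases j₁ k₀ with h | h | h | h <;> rw [h]
  · exact ⟨k₀, k₀, hk₀, Or.inl rfl, Or.inl rfl⟩
  · exact ⟨k₀, k₀ + 3, hk₀, Or.inr rfl, Or.inl rfl⟩
  · exact ⟨k₀, k₀, hk₀, Or.inl rfl, Or.inr (hadj k₀)⟩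
  · refine ⟨k₀, k₀ + 3, hk₀, Or.inr rfl, Or.inr ?_⟩
    have := hadj' (k₀ + 2)
    rwa [fin4_add_two_add_one] at this

/-- Cuts from a plaquette `c₀ ∉ D` at, or next to, a plaquette at a frozen bond of a hole-free `Λ`:
for every `R`, a plaquette walk from `c₀` leaving `sqBox c₀ R` avoiding the all-touch plaquettes of
`D`. [cite: Smirnov2010, §3] -/
theorem exists_cut_of_holeFree' {Λ : Finset (Site 2)} (hΛ : HoleFree (↑Λ : Set (Site 2))) {a : Site 2} {k₀ j₀ : Fin 4}
    (ha : a ∉ Λ) (hk₀ : a + cornerUnit k₀ ∉ Λ) (hj₀ : j₀ = k₀ ∨ j₀ = k₀ + 3) {D : Finset (Site 2)} {c₀ : Site 2}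
    (hc₀D : c₀ ∉ D) (hc₀ : c₀ = faceAt a j₀ ∨ (zdGraph 2).Adj c₀ (faceAt a j₀)) (R : ℕ) :
    ∃ (d : Site 2) (q : (zdGraph 2).Walk c₀ d), d ∉ sqBox c₀ R ∧
      ∀ z ∈ q.support, ¬ (z ∈ D ∧ ∀ j : Fin 4, SideTouch Λ z j) := by
  rcases hc₀ with rfl | hadj
  · exact exists_cut_of_holeFree hΛ ha hk₀ hj₀ D R
  · obtain ⟨d, q, hd, hq⟩ := exists_cut_of_holeFree hΛ ha hk₀ hj₀ D (R + 1)
    refine ⟨d, Walk.cons hadj q, fun hdR => hd ?_, fun z hz => ?_⟩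
    · have h1 : c₀ ∈ sqBox (faceAt a j₀) 1 := by
        have := mem_sqBox_succ_of_adj (n := 0) (p := faceAt a j₀) (by rw [mem_sqBox]; simp) hadj.symm
        simpa using this
      have := mem_sqBox_of_mem_sqBox h1 hdR
      push_cast at this ⊢
      rwa [add_comm] at this
    · rw [Walk.support_cons, List.mem_cons] at hz
      rcases hz with rfl | hz
      · exact fun h => hc₀D h.1
      · exact hq z hz

/-- **The power decay of `kcModHM` near a frozen bond with dead cemetery** (the hypotheses of
`end_decay_of_cuts` discharged for `V = kcModHM Λ D g_V`, `0 ≤ g_V ≤ 1`, `g_V = 0` at the frozen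
corners of the plaquettes of `D` in `sqBox ĝ R₀`, `Λ` hole-free). [cite: ChelkakSmirnov2012Ising, proof of Thm. 6.1, eq. (6.10)] -/
theorem kcModHM_end_decay {Λ : Finset (Site 2)} (hΛ : HoleFree (↑Λ : Set (Site 2))) (D : Finset (Site 2))
    {gV : Site 2 → ℝ} (hg1 : ∀ x, gV x ≤ 1)
    {a : Site 2} {k₀ j₀ : Fin 4} (ha : a ∉ Λ) (hk₀ : a + cornerUnit k₀ ∉ Λ) (hj₀ : j₀ = k₀ ∨ j₀ = k₀ + 3)
    {c₀ : Site 2} (hc₀D : c₀ ∉ D) (hc₀ : c₀ = faceAt a j₀ ∨ (zdGraph 2).Adj c₀ (faceAt a j₀)) {R₀ : ℕ}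
    (hdead : ∀ g ∈ D, g ∈ sqBox c₀ R₀ → ∀ j : Fin 4, ¬ SideTouch Λ g j → gV (g + cornerOff j) = 0) :
    ∀ r : ℕ, r ≤ R₀ → ∀ w ∈ sqBox c₀ r, kcModHM Λ D gV w ≤ endDecayConst * endProfile R₀ r := by
  have hV1 : ∀ x, kcModHM Λ D gV x ≤ 1 := kcModHM_le_one Λ D hg1
  have hVD : ∀ x ∉ D, kcModHM Λ D gV x = 0 := fun x hx => kcModHM_of_not_mem Λ D gV hx
  have hharm : ∀ f ∈ D, (∀ j : Fin 4, SideTouch Λ f j) → latticeLaplacian (kcModHM Λ D gV) f = 0 :=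
    fun f hf hall => latticeLaplacian_kcModHM Λ D gV hf hall
  have hcontr : ∀ g ∈ D, g ∈ sqBox c₀ R₀ → (∃ j : Fin 4, ¬ SideTouch Λ g j) → ∀ m : ℝ, 0 ≤ m →
      (∀ j : Fin 4, SideTouch Λ g j → kcModHM Λ D gV (sideNbr g j) ≤ m) → kcModHM Λ D gV g ≤ endTheta * m := by
    intro g hg hgbox hj m hm0 hm
    obtain ⟨j, hj⟩ := hj
    exact kcModHM_le_contract Λ D hg hj (fun j' hj' => hdead g hg hgbox j' hj') hm0 hm
  have hdec := end_decay_of_cuts Λ hV1 hVD hharm hcontr (fun R _ => exists_cut_of_holeFree' hΛ ha hk₀ hj₀ hc₀D hc₀ R)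
  intro r hr w hw
  by_cases hwD : w ∈ D
  · exact hdec r hr w hwD hw
  · rw [hVD w hwD]; exact mul_nonneg endDecayConst_pos.le (endProfile_pos R₀ r).le

/-- `γ ≤ 1`. [folklore] -/
theorem endDecayExp_le_one : endDecayExp ≤ 1 := endDecayExp_le.trans (by norm_num)

/-- **The constant of the end flux**, `(128/γ + 288) A`. [cite: ChelkakSmirnov2012Ising, proof of Thm. 6.1, eq. (6.10)] -/
def endRunConst : ℝ := (128 / endDecayExp + 288) * endDecayConst

/-- `0 < (128/γ + 288) A`. [folklore] -/
theorem endRunConst_pos : 0 < endRunConst := by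
  unfold endRunConst
  have := endDecayExp_pos
  have := endDecayConst_pos
  positivity

/-- **The end flux from above** (Chelkak–Smirnov's (6.10):
`∑_{(p p_μ)} V(u_int) H̃ tan θ ≤ const · ∑ δ · dist(u; p)^{-(1-β)} ≤ const · μ^β`). Let `c₀ ∉ D` be a
plaquette at, or next to, a plaquette at a frozen bond of the hole-free `Λ`, and `c₀ + n e_τ`,
`0 ≤ n ≤ 2L`, a straight run of plaquettes off `D` (the end of the contour), with `2L + 2 ≤ R₀`, dead
cemetery at the frozen corners of `D` inside `sqBox c₀ R₀`, and, for `8 ≤ i ≤ L`, the lateral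
half-boxes `{1 ≤ b ≤ i/8, |t| ≤ i/8}` over `c₀ + i e_τ` meeting `D` only in all-touch plaquettes. Then
`∑_{i ≤ L} ∑_m [c₀ + i e_τ + e_m ∈ D] V(c₀ + i e_τ + e_m) ≤ (128/γ + 288) A ((L+1)/(R₀+1))^γ` for
`V = kcModHM Λ D g_V`. [cite: ChelkakSmirnov2012Ising, proof of Thm. 6.1, eq. (6.10)] -/
theorem endRun_sum_le {Λ : Finset (Site 2)} (hΛ : HoleFree (↑Λ : Set (Site 2))) (D : Finset (Site 2))
    {gV : Site 2 → ℝ} (hg0 : ∀ x, 0 ≤ gV x) (hg1 : ∀ x, gV x ≤ 1)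
    {a : Site 2} {k₀ j₀ : Fin 4} (ha : a ∉ Λ) (hk₀ : a + cornerUnit k₀ ∉ Λ) (hj₀ : j₀ = k₀ ∨ j₀ = k₀ + 3)
    {c₀ : Site 2} (hc₀ : c₀ = faceAt a j₀ ∨ (zdGraph 2).Adj c₀ (faceAt a j₀))
    (kτ : Fin 4) {L R₀ : ℕ} (hL : 1 ≤ L) (hLR : 2 * L + 2 ≤ R₀)
    (hdead : ∀ g ∈ D, g ∈ sqBox c₀ R₀ → ∀ j : Fin 4, ¬ SideTouch Λ g j → gV (g + cornerOff j) = 0)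
    (hrun : ∀ n : ℤ, 0 ≤ n → n ≤ 2 * L → runPt c₀ kτ n ∉ D)
    (hcone : ∀ i : ℕ, 8 ≤ i → i ≤ L → ∀ m : Fin 4, (m = kτ + 1 ∨ m = kτ + 3) →
      ∀ z ∈ flatHalfBox m (runPt c₀ kτ i) (i / 8) (i / 8), z ∈ D → ∀ j : Fin 4, SideTouch Λ z j) :
    ∑ i ∈ Finset.range (L + 1), ∑ m : Fin 4,
        (if runPt c₀ kτ i + cornerUnit m ∈ D then kcModHM Λ D gV (runPt c₀ kτ i + cornerUnit m) else 0) ≤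
      endRunConst * (((L : ℝ) + 1) / ((R₀ : ℝ) + 1)) ^ endDecayExp := by
  classical
  have hc₀D : c₀ ∉ D := by have := hrun 0 le_rfl (by positivity); rwa [runPt_zero] at this
  set V := kcModHM Λ D gV with hV
  set γ := endDecayExp with hγ
  set A := endDecayConst with hA
  have hγ0 : 0 < γ := endDecayExp_pos
  have hγ1 : γ ≤ 1 := endDecayExp_le_one
  have hA0 : 0 < A := endDecayConst_pos
  have hV0 : ∀ x, 0 ≤ V x := kcModHM_nonneg Λ D hg0
  have hVD : ∀ x ∉ D, V x = 0 := fun x hx => kcModHM_of_not_mem Λ D gV hx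
  have hdec := kcModHM_end_decay hΛ D hg1 ha hk₀ hj₀ hc₀D hc₀ hdead
  have hR : (0 : ℝ) < (R₀ : ℝ) + 1 := by positivity
  set φ : ℕ → ℝ := endProfile R₀ with hφ
  have hφpos : ∀ n, 0 < φ n := endProfile_pos R₀
  -- the term function
  set F : ℕ → Fin 4 → ℝ := fun i m => if runPt c₀ kτ i + cornerUnit m ∈ D then V (runPt c₀ kτ i + cornerUnit m) else 0 with hF
  have hF0 : ∀ i m, 0 ≤ F i m := fun i m => by simp only [hF]; split_ifs <;> [exact hV0 _; exact le_rfl]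
  -- (t1) the crude bound
  have hcrude : ∀ i : ℕ, i ≤ L → ∀ m : Fin 4, F i m ≤ A * φ (i + 1) := by
    intro i hi m
    simp only [hF]
    split_ifs with hD
    · refine hdec (i + 1) (by omega) _ ?_
      have h1 : runPt c₀ kτ i ∈ sqBox c₀ (i : ℤ) := runPt_mem_sqBox c₀ kτ i (by rw [abs_of_nonneg (by positivity)])
      have := mem_sqBox_succ_of_adj h1 (zdGraph_adj_add_cornerUnit _ m)
      exact_mod_cast this
    · exact mul_nonneg hA0.le (hφpos _).le
  -- (t2) the along-run terms vanish for `1 ≤ i ≤ L`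
  have halong : ∀ i : ℕ, 1 ≤ i → i ≤ L → F i kτ = 0 ∧ F i (kτ + 2) = 0 := by
    intro i hi1 hiL
    simp only [hF]
    constructor
    · rw [if_neg]; rw [runPt_add_cornerUnit]; exact hrun _ (by positivity) (by omega)
    · rw [if_neg]; rw [runPt_add_cornerUnit_add_two]; exact hrun _ (by omega) (by omega)
  -- (t3) the lateral terms for `8 ≤ i ≤ L`
  have hlat : ∀ i : ℕ, 8 ≤ i → i ≤ L → ∀ m : Fin 4, (m = kτ + 1 ∨ m = kτ + 3) →
      F i m ≤ 4 * (A * φ (i + i / 8 + 1)) / (((i / 8 : ℕ) : ℝ) + 2) := by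
    intro i hi4 hiL m hm
    have hMnn : 0 ≤ A * φ (i + i / 8 + 1) := mul_nonneg hA0.le (hφpos _).le
    simp only [hF]
    split_ifs with hD
    · have hℓ : 1 ≤ i / 8 := (Nat.le_div_iff_mul_le (by norm_num)).2 (by omega)
      refine le_of_subharmonicOn_flatHalfBox m (runPt c₀ kτ i) hℓ hMnn ?_ ?_ ?_
      · -- subharmonicity on the half-box
        intro z hz
        by_cases hzD : z ∈ D
        · exact (latticeLaplacian_kcModHM Λ D gV hzD (hcone i hi4 hiL m hm z hz hzD)).ge
        · rw [latticeLaplacian_eq, hVD z hzD, mul_zero, sub_zero]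
          exact Finset.sum_nonneg fun k _ => hV0 _
      · -- the flat piece: run plaquettes, off `D`
        intro z hb ht
        have e := eq_of_frame m (runPt c₀ kτ i) z
        rw [hb, zero_zsmul, add_zero] at e
        rw [abs_le] at ht
        have hdiv : i / 8 ≤ i := Nat.div_le_self i 8
        rcases hm with rfl | rfl
        · rw [fin4_add_one_add_one, runPt_add_zsmul_add_two] at e
          rw [e, hVD _ (hrun _ (by omega) (by omega))]
        · rw [fin4_add_three_add_one, runPt_add_zsmul] at e
          rw [e, hVD _ (hrun _ (by omega) (by omega))]
      · -- the rest of the frame: the decay bound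
        intro z hz _
        have h1 : runPt c₀ kτ i ∈ sqBox c₀ (i : ℤ) := runPt_mem_sqBox c₀ kτ i (by rw [abs_of_nonneg (by positivity)])
        have h2 := mem_sqBox_of_mem_sqBox h1 hz
        refine hdec (i + i / 8 + 1) ?_ z (by exact_mod_cast h2)
        have : i + i / 8 + 1 ≤ L + L / 8 + 1 := by
          have := Nat.div_le_div_right (c := 8) hiL; omega
        have : L / 8 ≤ L := Nat.div_le_self L 8
        omega
    · positivity
  -- (t3') numerics of the lateral bound
  have hlat' : ∀ i : ℕ, 8 ≤ i → i ≤ L →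
      4 * (A * φ (i + i / 8 + 1)) / (((i / 8 : ℕ) : ℝ) + 2) ≤ 64 * A * (((i : ℝ) + 1) ^ (γ - 1) / ((R₀ : ℝ) + 1) ^ γ) := by
    intro i hi4 hiL
    have hi0 : (0 : ℝ) < (i : ℝ) + 1 := by positivity
    -- `φ (i + i/8 + 1) ≤ 2 ((i+1)/(R₀+1))^γ`
    have hφle : φ (i + i / 8 + 1) ≤ 2 * ((((i : ℝ) + 1) / ((R₀ : ℝ) + 1)) ^ γ) := by
      have hq : ((((i + i / 8 + 1 : ℕ) : ℝ) + 1) / ((R₀ : ℝ) + 1)) ≤ 2 * (((i : ℝ) + 1) / ((R₀ : ℝ) + 1)) := by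
        rw [mul_div_assoc']
        apply div_le_div_of_nonneg_right _ hR.le
        have : ((i / 8 : ℕ) : ℝ) ≤ (i : ℝ) := by exact_mod_cast Nat.div_le_self i 8
        push_cast; linarith
      calc φ (i + i / 8 + 1) = ((((i + i / 8 + 1 : ℕ) : ℝ) + 1) / ((R₀ : ℝ) + 1)) ^ γ := rfl
        _ ≤ (2 * (((i : ℝ) + 1) / ((R₀ : ℝ) + 1))) ^ γ := Real.rpow_le_rpow (by positivity) hq hγ0.le
        _ = (2 : ℝ) ^ γ * (((i : ℝ) + 1) / ((R₀ : ℝ) + 1)) ^ γ := Real.mul_rpow (by norm_num) (by positivity)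
        _ ≤ 2 * (((i : ℝ) + 1) / ((R₀ : ℝ) + 1)) ^ γ := by
            apply mul_le_mul_of_nonneg_right _ (Real.rpow_nonneg (by positivity) _)
            calc (2 : ℝ) ^ γ ≤ (2 : ℝ) ^ (1 : ℝ) := Real.rpow_le_rpow_of_exponent_le (by norm_num) hγ1
              _ = 2 := Real.rpow_one 2
    -- `1/((i/8) + 2) ≤ 8/(i+1)`
    have hden : (4 : ℝ) * (1 / (((i / 8 : ℕ) : ℝ) + 2)) ≤ 32 / ((i : ℝ) + 1) := by
      have h4 : (i : ℝ) + 1 ≤ 8 * (((i / 8 : ℕ) : ℝ) + 2) := by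
        have := Nat.div_add_mod i 8
        have hmod := Nat.mod_lt i (show 0 < 8 by norm_num)
        have : ((i : ℕ) : ℝ) = 8 * ((i / 8 : ℕ) : ℝ) + ((i % 8 : ℕ) : ℝ) := by exact_mod_cast this.symm
        have hmod' : ((i % 8 : ℕ) : ℝ) < 8 := by exact_mod_cast hmod
        linarith
      rw [mul_one_div, div_le_div_iff₀ (by positivity) hi0]
      nlinarith
    have hrpow : (((i : ℝ) + 1) / ((R₀ : ℝ) + 1)) ^ γ = ((i : ℝ) + 1) ^ (γ - 1) * ((i : ℝ) + 1) / ((R₀ : ℝ) + 1) ^ γ := by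
      rw [Real.div_rpow hi0.le hR.le, Real.rpow_sub_one hi0.ne']
      field_simp
    calc 4 * (A * φ (i + i / 8 + 1)) / (((i / 8 : ℕ) : ℝ) + 2)
        = A * φ (i + i / 8 + 1) * (4 * (1 / (((i / 8 : ℕ) : ℝ) + 2))) := by ring
      _ ≤ A * (2 * (((i : ℝ) + 1) / ((R₀ : ℝ) + 1)) ^ γ) * (32 / ((i : ℝ) + 1)) := by
          apply mul_le_mul (mul_le_mul_of_nonneg_left hφle hA0.le) hden (by positivity)
          exact mul_nonneg hA0.le (by positivity)
      _ = 64 * A * (((i : ℝ) + 1) ^ (γ - 1) / ((R₀ : ℝ) + 1) ^ γ) := by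
          rw [hrpow]; field_simp; ring
  -- per-index bound
  set e4 : ℝ := A * φ 8 with he4
  have hrow : ∀ i ∈ Finset.range (L + 1), ∑ m : Fin 4, F i m ≤
      (if i < 8 then 4 * e4 else 0) + 128 * A * (((i : ℝ) + 1) ^ (γ - 1) / ((R₀ : ℝ) + 1) ^ γ) := by
    intro i hi
    have hiL : i ≤ L := Nat.lt_succ_iff.1 (Finset.mem_range.1 hi)
    have hpow0 : 0 ≤ 128 * A * (((i : ℝ) + 1) ^ (γ - 1) / ((R₀ : ℝ) + 1) ^ γ) := by positivity
    by_cases hi4 : i < 8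
    · rw [if_pos hi4]
      have hle : ∀ m : Fin 4, F i m ≤ e4 := fun m => (hcrude i hiL m).trans
        (mul_le_mul_of_nonneg_left (endProfile_mono R₀ (by omega)) hA0.le)
      calc ∑ m : Fin 4, F i m ≤ ∑ _m : Fin 4, e4 := Finset.sum_le_sum fun m _ => hle m
        _ = 4 * e4 := by simp [Finset.sum_const, Finset.card_univ]
        _ ≤ _ := by linarith
    · rw [if_neg hi4, zero_add]
      push Not at hi4
      have hsum : ∑ m : Fin 4, F i m = F i kτ + F i (kτ + 1) + F i (kτ + 2) + F i (kτ + 3) := by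
        rw [← Equiv.sum_comp (Equiv.addLeft kτ), Fin.sum_univ_four]
        simp only [Equiv.coe_addLeft, add_zero]
      obtain ⟨h0, h2⟩ := halong i (by omega) hiL
      rw [hsum, h0, h2, zero_add, add_zero]
      have h1 := (hlat i hi4 hiL (kτ + 1) (Or.inl rfl)).trans (hlat' i hi4 hiL)
      have h3 := (hlat i hi4 hiL (kτ + 3) (Or.inr rfl)).trans (hlat' i hi4 hiL)
      linarith
  -- summation
  have hmain := Finset.sum_le_sum hrow
  rw [Finset.sum_add_distrib] at hmain
  have hA' : ∑ i ∈ Finset.range (L + 1), (if i < 8 then 4 * e4 else (0 : ℝ)) ≤ 32 * e4 := by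
    have he4' : 0 ≤ e4 := mul_nonneg hA0.le (hφpos 8).le
    calc ∑ i ∈ Finset.range (L + 1), (if i < 8 then 4 * e4 else (0 : ℝ))
        = ∑ i ∈ (Finset.range (L + 1)).filter (fun i => i < 8), 4 * e4 := by rw [Finset.sum_filter]
      _ = ((Finset.range (L + 1)).filter (fun i => i < 8)).card * (4 * e4) := by rw [Finset.sum_const, nsmul_eq_mul]
      _ ≤ 8 * (4 * e4) := by
          apply mul_le_mul_of_nonneg_right _ (by positivity)
          have : ((Finset.range (L + 1)).filter (fun i => i < 8)) ⊆ Finset.range 8 := by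
            intro i hi; rw [Finset.mem_filter] at hi; exact Finset.mem_range.2 hi.2
          exact_mod_cast (Finset.card_le_card this).trans (by simp)
      _ = 32 * e4 := by ring
  have hB' : ∑ i ∈ Finset.range (L + 1), 128 * A * (((i : ℝ) + 1) ^ (γ - 1) / ((R₀ : ℝ) + 1) ^ γ) ≤
      128 * A * ((((L : ℝ) + 1)) ^ γ / γ / ((R₀ : ℝ) + 1) ^ γ) := by
    rw [← Finset.mul_sum, ← Finset.sum_div]
    apply mul_le_mul_of_nonneg_left _ (by positivity)
    apply div_le_div_of_nonneg_right _ (by positivity)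
    have := sum_rpow_sub_one_le hγ0 hγ1 (L + 1)
    push_cast at this
    exact this
  -- `e4 ≤ 9 ((L+1)/(R₀+1))^γ`
  have he4le : e4 ≤ A * (9 * ((((L : ℝ) + 1) / ((R₀ : ℝ) + 1)) ^ γ)) := by
    simp only [he4]
    apply mul_le_mul_of_nonneg_left _ hA0.le
    have hq : (((8 : ℕ) : ℝ) + 1) / ((R₀ : ℝ) + 1) ≤ 9 * (((L : ℝ) + 1) / ((R₀ : ℝ) + 1)) := by
      rw [mul_div_assoc']
      apply div_le_div_of_nonneg_right _ hR.le
      have : (1 : ℝ) ≤ (L : ℝ) := by exact_mod_cast hL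
      push_cast; linarith
    calc φ 8 = ((((8 : ℕ) : ℝ) + 1) / ((R₀ : ℝ) + 1)) ^ γ := rfl
      _ ≤ (9 * (((L : ℝ) + 1) / ((R₀ : ℝ) + 1))) ^ γ := Real.rpow_le_rpow (by positivity) hq hγ0.le
      _ = (9 : ℝ) ^ γ * (((L : ℝ) + 1) / ((R₀ : ℝ) + 1)) ^ γ := Real.mul_rpow (by norm_num) (by positivity)
      _ ≤ 9 * (((L : ℝ) + 1) / ((R₀ : ℝ) + 1)) ^ γ := by
          apply mul_le_mul_of_nonneg_right _ (Real.rpow_nonneg (by positivity) _)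
          calc (9 : ℝ) ^ γ ≤ (9 : ℝ) ^ (1 : ℝ) := Real.rpow_le_rpow_of_exponent_le (by norm_num) hγ1
            _ = 9 := Real.rpow_one 9
  have hfin : (((L : ℝ) + 1)) ^ γ / γ / ((R₀ : ℝ) + 1) ^ γ = (1 / γ) * ((((L : ℝ) + 1) / ((R₀ : ℝ) + 1)) ^ γ) := by
    rw [Real.div_rpow (by positivity) hR.le]; field_simp
  rw [hfin] at hB'
  have hpos : 0 ≤ (((L : ℝ) + 1) / ((R₀ : ℝ) + 1)) ^ γ := Real.rpow_nonneg (by positivity) _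
  calc ∑ i ∈ Finset.range (L + 1), ∑ m : Fin 4, F i m
      ≤ 32 * e4 + 128 * A * ((1 / γ) * ((((L : ℝ) + 1) / ((R₀ : ℝ) + 1)) ^ γ)) := by linarith
    _ ≤ 32 * (A * (9 * ((((L : ℝ) + 1) / ((R₀ : ℝ) + 1)) ^ γ))) + 128 * A * ((1 / γ) * ((((L : ℝ) + 1) / ((R₀ : ℝ) + 1)) ^ γ)) := by
        linarith
    _ = endRunConst * (((L : ℝ) + 1) / ((R₀ : ℝ) + 1)) ^ γ := by
        simp only [endRunConst, hγ, hA]; field_simp; ring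

/-! ### The assembled inequality -/

/-- **The lattice inequality of the sign condition** (Chelkak–Smirnov 2012, proof of Thm. 6.1,
(6.8)–(6.10), and Remark 6.3, in the boundary-modification rendering). Data: a hole-free free set
`Λ`; a finite set `D` of plaquettes; a function `u` modified-subharmonic with zero cemetery on `D`,
with `u · g_V ≥ 0` at the frozen corners of the plaquettes of `D`, `u ≤ -η` at the exit targets in
`Mid` and `u ≤ M_b` at the others (`η, M_b ≥ 0`); cemetery data `0 ≤ g_V ≤ 1` of
`V = kcModHM Λ D g_V`; a flat middle piece of `h + 1` plaquettes of `Mid` with all-touch half-boxes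
over it whose far sides are covered by the small boxes of a Harnack chain `c_0, …, c_J` (big boxes
all-touch in `D`) started at an all-touch plaquette `c_0 ∈ D ∩ sqBox ĝ ρ` next to a deep frozen bond
(`ĝ = faceAt a j₀`, live cemetery and closedness under touching steps inside `sqBox ĝ R`,
`2C((ρ+1)/(R+1))^β ≤ 1`); and finitely many end runs `c_e + n e_{τ_e}` from plaquettes at (or next to)
frozen bonds carrying
every non-`Mid` exit target within index `L_e`, each with the hypotheses of `endRun_sum_le`. Then
`η · κ (c_*/2)^{J+1} / 16 ≤ M_b · (128/γ + 288) A · ∑_e ((L_e+1)/(R₀^e+1))^γ`.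
[cite: ChelkakSmirnov2012Ising, proof of Thm. 6.1, eqs. (6.8)–(6.10) and Remark 6.3] -/
theorem kc_sign_condition_ineq {Λ : Finset (Site 2)} (hΛ : HoleFree (↑Λ : Set (Site 2))) (D : Finset (Site 2))
    (gV u : Site 2 → ℝ) (hg0 : ∀ x, 0 ≤ gV x) (hg1 : ∀ x, gV x ≤ 1)
    (hsub : ∀ f ∈ D, 0 ≤ kcModLaplacian Λ (fun _ => 0) u f)
    (hu0 : ∀ f ∈ D, ∀ j : Fin 4, ¬ SideTouch Λ f j → 0 ≤ u f * gV (f + cornerOff j))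
    (Mid : Site 2 → Prop) [DecidablePred Mid] {η Mb : ℝ} (hη : 0 ≤ η) (hMb : 0 ≤ Mb)
    (hMid : ∀ f ∈ D, ∀ j : Fin 4, SideTouch Λ f j → sideNbr f j ∉ D → Mid (sideNbr f j) → u (sideNbr f j) ≤ -η)
    (hRest : ∀ f ∈ D, ∀ j : Fin 4, SideTouch Λ f j → sideNbr f j ∉ D → ¬ Mid (sideNbr f j) → u (sideNbr f j) ≤ Mb)
    -- the flat middle piece
    (km : Fin 4) (zm : Site 2) {h : ℕ} (hh : 1 ≤ h)
    (hMidRun : ∀ t : ℕ, t ≤ h → Mid (runPt zm (km + 1) t) ∧ runPt zm (km + 1) t ∉ D ∧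
      runPt zm (km + 1) t + cornerUnit km ∈ D ∧ SideTouch Λ (runPt zm (km + 1) t + cornerUnit km) (km + 3))
    (hMidBox : ∀ t : ℕ, t ≤ h → ∀ z ∈ flatHalfBox km (runPt zm (km + 1) t) h (2 * h + 1), z ∈ D ∧ ∀ j : Fin 4, SideTouch Λ z j)
    -- the Harnack chain from the seed to the far sides
    {kH : ℕ} (hkH : 0 < kH) (cH : ℕ → Site 2) (J : ℕ)
    (hHbig : ∀ j, j ≤ J → ∀ z ∈ mW (cH j) kH, z ∈ D ∧ ∀ i : Fin 4, SideTouch Λ z i)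
    (hHstep : ∀ j, j < J → cH (j + 1) ∈ mB (cH j) kH)
    (hHfar : ∀ t : ℕ, t ≤ h → ∀ z, nCoord km (runPt zm (km + 1) t) z = h + 1 →
      |tCoord km (runPt zm (km + 1) t) z| ≤ 2 * h + 1 → ∃ j, j ≤ J ∧ z ∈ mB (cH j) kH)
    -- the seed at a deep frozen bond
    {a : Site 2} {k₀ j₀ : Fin 4} (ha : a ∉ Λ) (hk₀ : a + cornerUnit k₀ ∉ Λ) (hj₀ : j₀ = k₀ ∨ j₀ = k₀ + 3)
    {ρ R : ℕ} (hρR : 2 * beurlingConst * (((ρ : ℝ) + 1) / ((R : ℝ) + 1)) ^ beurlingExp ≤ 1)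
    (hclosed : ∀ v ∈ D, (∀ j : Fin 4, SideTouch Λ v j) → ∀ m : Fin 4, v + cornerUnit m ∈ sqBox (faceAt a j₀) R → v + cornerUnit m ∈ D)
    (hE : ∀ w ∈ D, w ∈ sqBox (faceAt a j₀) R → ∀ j : Fin 4, ¬ SideTouch Λ w j → gV (w + cornerOff j) = 1)
    (hc0D : cH 0 ∈ D) (hc0 : cH 0 ∈ sqBox (faceAt a j₀) ρ)
    -- the end runs
    {ι : Type*} (Ends : Finset ι) (cE aE : ι → Site 2) (kE jE τE : ι → Fin 4) (LE RE : ι → ℕ)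
    (haE : ∀ e ∈ Ends, aE e ∉ Λ ∧ aE e + cornerUnit (kE e) ∉ Λ ∧ (jE e = kE e ∨ jE e = kE e + 3) ∧
      (cE e = faceAt (aE e) (jE e) ∨ (zdGraph 2).Adj (cE e) (faceAt (aE e) (jE e))))
    (hLE : ∀ e ∈ Ends, 1 ≤ LE e ∧ 2 * LE e + 2 ≤ RE e)
    (hdeadE : ∀ e ∈ Ends, ∀ g ∈ D, g ∈ sqBox (cE e) (RE e) → ∀ j : Fin 4, ¬ SideTouch Λ g j → gV (g + cornerOff j) = 0)
    (hrunE : ∀ e ∈ Ends, ∀ n : ℤ, 0 ≤ n → n ≤ 2 * LE e → runPt (cE e) (τE e) n ∉ D)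
    (hconeE : ∀ e ∈ Ends, ∀ i : ℕ, 8 ≤ i → i ≤ LE e → ∀ m : Fin 4, (m = τE e + 1 ∨ m = τE e + 3) →
      ∀ z ∈ flatHalfBox m (runPt (cE e) (τE e) i) (i / 8) (i / 8), z ∈ D → ∀ j : Fin 4, SideTouch Λ z j)
    (hcarry : ∀ f ∈ D, ∀ j : Fin 4, SideTouch Λ f j → sideNbr f j ∉ D → ¬ Mid (sideNbr f j) →
      ∃ e ∈ Ends, ∃ i : ℕ, i ≤ LE e ∧ sideNbr f j = runPt (cE e) (τE e) i) :
    η * (modKappa * (maneuverConst / 2) ^ (J + 1) / 16) ≤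
      Mb * (endRunConst * ∑ e ∈ Ends, ((((LE e : ℝ) + 1) / ((RE e : ℝ) + 1)) ^ endDecayExp)) := by
  classical
  set V := kcModHM Λ D gV with hV
  have hV0 : ∀ x, 0 ≤ V x := kcModHM_nonneg Λ D hg0
  -- the seed and the Harnack chain: `V ≥ m₀` on the far sides
  have hc0T : ∀ i : Fin 4, SideTouch Λ (cH 0) i := by
    have h0 : cH 0 ∈ mW (cH 0) kH := by
      simp only [mW, Set.mem_setOf_eq, sub_self, abs_zero]; constructor <;> positivity
    exact (hHbig 0 (Nat.zero_le J) _ h0).2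
  have hseed : modKappa / 8 ≤ V (cH 0) := seed_lower_bound hΛ D hg0 ha hk₀ hj₀ hρR hclosed hE hc0D hc0T hc0
  set m₀ : ℝ := (maneuverConst / 2) ^ (J + 1) * (modKappa / 8) with hm₀
  have hm₀0 : 0 ≤ m₀ := mul_nonneg (pow_nonneg (by linarith [maneuverConst_pos]) _) (by linarith [modKappa_pos])
  have hharmH : ∀ j, j ≤ J → IsLatticeHarmonicOn V (mW (cH j) kH) := fun j hj =>
    isLatticeHarmonicOn_kcModHM Λ D gV (hHbig j hj)
  have hfar : ∀ t : ℕ, t ≤ h → ∀ z, nCoord km (runPt zm (km + 1) t) z = h + 1 →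
      |tCoord km (runPt zm (km + 1) t) z| ≤ 2 * h + 1 → m₀ ≤ V z := by
    intro t ht z hb htc
    have hz := hHfar t ht z hb htc
    calc m₀ ≤ (maneuverConst / 2) ^ (J + 1) * V (cH 0) :=
          mul_le_mul_of_nonneg_left hseed (pow_nonneg (by linarith [maneuverConst_pos]) _)
      _ ≤ V z := harnack_chain_lower_bound hV0 hkH cH J hharmH hHstep hz
  -- the middle flux from below
  have hmid : m₀ / 2 ≤ exitSum Λ D Mid V := half_le_exitSum_mid Λ D Mid hg0 km zm hh hm₀0 hMidRun hMidBox hfar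
  -- the split of (★)
  have hsplit := exitSum_split Λ D gV u hg0 hsub hu0 Mid hMid hRest
  -- the end flux from above
  have hrest : exitSum Λ D (fun g => ¬ Mid g) V ≤
      ∑ e ∈ Ends, endRunConst * ((((LE e : ℝ) + 1) / ((RE e : ℝ) + 1)) ^ endDecayExp) := by
    refine (exitSum_rest_le_runs Λ D Mid hV0 Ends (fun e n => runPt (cE e) (τE e) n) LE hcarry).trans ?_
    refine Finset.sum_le_sum fun e he => ?_
    obtain ⟨ha', hk', hj', hc'⟩ := haE e he
    obtain ⟨hL', hLR'⟩ := hLE e he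
    exact endRun_sum_le hΛ D hg0 hg1 ha' hk' hj' hc' (τE e) hL' hLR' (hdeadE e he) (hrunE e he) (hconeE e he)
  -- combine: `η m₀/2 ≤ η S_Mid ≤ Mb S_Rest ≤ Mb Σ`
  calc η * (modKappa * (maneuverConst / 2) ^ (J + 1) / 16) = η * (m₀ / 2) := by simp only [hm₀]; ring
    _ ≤ η * exitSum Λ D Mid V := mul_le_mul_of_nonneg_left hmid hη
    _ ≤ Mb * exitSum Λ D (fun g => ¬ Mid g) V := hsplit
    _ ≤ Mb * ∑ e ∈ Ends, endRunConst * ((((LE e : ℝ) + 1) / ((RE e : ℝ) + 1)) ^ endDecayExp) :=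
        mul_le_mul_of_nonneg_left hrest hMb
    _ = Mb * (endRunConst * ∑ e ∈ Ends, ((((LE e : ℝ) + 1) / ((RE e : ℝ) + 1)) ^ endDecayExp)) := by
        congr 1; rw [Finset.mul_sum]

/-! ### The variant with a signed middle and a strictly negative flat piece

Chelkak–Smirnov drop the middle terms away from the fixed flat piece using only the SIGN
`H̃ < 0` there ("Taking into account `H̃^δ < 0` which holds (if `δ` is small enough) for all `u ∈ C^δ`
lying `μ`-away from `p^δ, s^δ`"), the quantitative lower bound being needed on the flat piece only.
The following variants implement this: exits into `Mid` targets have `u ≤ 0`, exits into the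
sub-family `Flat ⊆ Mid` have `u ≤ -η`. -/

/-- **The split with a signed middle**: if `u ≤ 0` at every middle exit target, `u ≤ -η` at the
flat ones (`Flat ⊆ Mid`) and `u ≤ M_b` at the others, then
`η · (exit flux into Flat) ≤ M_b · (exit flux outside Mid)`. [cite: ChelkakSmirnov2012Ising, proof of Thm. 6.1, eqs. (6.8)–(6.10)] -/
theorem exitSum_split' (Λ D : Finset (Site 2)) (gV u : Site 2 → ℝ) (hgV : ∀ x, 0 ≤ gV x)
    (hsub : ∀ f ∈ D, 0 ≤ kcModLaplacian Λ (fun _ => 0) u f)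
    (hu0 : ∀ f ∈ D, ∀ j : Fin 4, ¬ SideTouch Λ f j → 0 ≤ u f * gV (f + cornerOff j))
    (Mid Flat : Site 2 → Prop) [DecidablePred Mid] [DecidablePred Flat] (hFlatMid : ∀ g, Flat g → Mid g) {η Mb : ℝ}
    (hMid0 : ∀ f ∈ D, ∀ j : Fin 4, SideTouch Λ f j → sideNbr f j ∉ D → Mid (sideNbr f j) → u (sideNbr f j) ≤ 0)
    (hFlat : ∀ f ∈ D, ∀ j : Fin 4, SideTouch Λ f j → sideNbr f j ∉ D → Flat (sideNbr f j) → u (sideNbr f j) ≤ -η)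
    (hRest : ∀ f ∈ D, ∀ j : Fin 4, SideTouch Λ f j → sideNbr f j ∉ D → ¬ Mid (sideNbr f j) → u (sideNbr f j) ≤ Mb) :
    η * exitSum Λ D Flat (kcModHM Λ D gV) ≤ Mb * exitSum Λ D (fun g => ¬ Mid g) (kcModHM Λ D gV) := by
  classical
  set V := kcModHM Λ D gV with hV
  have hV0 : ∀ x, 0 ≤ V x := kcModHM_nonneg Λ D hgV
  have hG := kcModHM_green_ineq Λ D gV u hgV hsub
  have hL : 0 ≤ modKappa * ∑ f ∈ D, u f * ∑ j : Fin 4, (if SideTouch Λ f j then 0 else gV (f + cornerOff j)) := by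
    refine mul_nonneg modKappa_pos.le (Finset.sum_nonneg fun f hf => ?_)
    rw [Finset.mul_sum]
    refine Finset.sum_nonneg fun j _ => ?_
    split_ifs with h
    · simp
    · exact hu0 f hf j h
  have hterm : ∀ f ∈ D, ∀ j : Fin 4,
      (if SideTouch Λ f j ∧ sideNbr f j ∉ D then V f * u (sideNbr f j) else 0) ≤
        (-η) * (if SideTouch Λ f j ∧ sideNbr f j ∉ D ∧ Flat (sideNbr f j) then V f else 0) +
          Mb * (if SideTouch Λ f j ∧ sideNbr f j ∉ D ∧ ¬ Mid (sideNbr f j) then V f else 0) := by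
    intro f hf j
    by_cases h1 : SideTouch Λ f j ∧ sideNbr f j ∉ D
    · by_cases h2 : Mid (sideNbr f j)
      · by_cases h3 : Flat (sideNbr f j)
        · rw [if_pos h1, if_pos ⟨h1.1, h1.2, h3⟩, if_neg (fun h => h.2.2 h2), mul_zero, add_zero]
          have := hFlat f hf j h1.1 h1.2 h3
          nlinarith [hV0 f]
        · rw [if_pos h1, if_neg (fun h => h3 h.2.2), if_neg (fun h => h.2.2 h2), mul_zero, mul_zero, add_zero]
          have := hMid0 f hf j h1.1 h1.2 h2
          nlinarith [hV0 f]
      · have h3 : ¬ Flat (sideNbr f j) := fun h => h2 (hFlatMid _ h)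
        rw [if_pos h1, if_neg (fun h => h3 h.2.2), if_pos ⟨h1.1, h1.2, h2⟩, mul_zero, zero_add]
        have := hRest f hf j h1.1 h1.2 h2
        nlinarith [hV0 f]
    · rw [if_neg h1, if_neg (fun h => h1 ⟨h.1, h.2.1⟩), if_neg (fun h => h1 ⟨h.1, h.2.1⟩)]; simp
  have hsum : ∑ f ∈ D, ∑ j : Fin 4, (if SideTouch Λ f j ∧ sideNbr f j ∉ D then V f * u (sideNbr f j) else 0) ≤
      (-η) * exitSum Λ D Flat V + Mb * exitSum Λ D (fun g => ¬ Mid g) V := by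
    simp only [exitSum, Finset.mul_sum, ← Finset.sum_add_distrib]
    exact Finset.sum_le_sum fun f hf => Finset.sum_le_sum fun j _ => hterm f hf j
  linarith

/-- **The lattice inequality of the sign condition, signed-middle form.** As
`kc_sign_condition_ineq`, but the middle exit targets only carry `u ≤ 0`, while `u ≤ -η` is
required on the flat piece `Flat ⊆ Mid` only (the plaquettes `zm + t e_{k+1}`, `t ≤ h`).
[cite: ChelkakSmirnov2012Ising, proof of Thm. 6.1, eqs. (6.8)–(6.10) and Remark 6.3] -/
theorem kc_sign_condition_ineq' {Λ : Finset (Site 2)} (hΛ : HoleFree (↑Λ : Set (Site 2))) (D : Finset (Site 2))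
    (gV u : Site 2 → ℝ) (hg0 : ∀ x, 0 ≤ gV x) (hg1 : ∀ x, gV x ≤ 1)
    (hsub : ∀ f ∈ D, 0 ≤ kcModLaplacian Λ (fun _ => 0) u f)
    (hu0 : ∀ f ∈ D, ∀ j : Fin 4, ¬ SideTouch Λ f j → 0 ≤ u f * gV (f + cornerOff j))
    (Mid Flat : Site 2 → Prop) [DecidablePred Mid] [DecidablePred Flat] (hFlatMid : ∀ g, Flat g → Mid g)
    {η Mb : ℝ} (hη : 0 ≤ η) (hMb : 0 ≤ Mb)
    (hMid0 : ∀ f ∈ D, ∀ j : Fin 4, SideTouch Λ f j → sideNbr f j ∉ D → Mid (sideNbr f j) → u (sideNbr f j) ≤ 0)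
    (hFlat : ∀ f ∈ D, ∀ j : Fin 4, SideTouch Λ f j → sideNbr f j ∉ D → Flat (sideNbr f j) → u (sideNbr f j) ≤ -η)
    (hRest : ∀ f ∈ D, ∀ j : Fin 4, SideTouch Λ f j → sideNbr f j ∉ D → ¬ Mid (sideNbr f j) → u (sideNbr f j) ≤ Mb)
    -- the flat middle piece
    (km : Fin 4) (zm : Site 2) {h : ℕ} (hh : 1 ≤ h)
    (hFlatRun : ∀ t : ℕ, t ≤ h → Flat (runPt zm (km + 1) t) ∧ runPt zm (km + 1) t ∉ D ∧
      runPt zm (km + 1) t + cornerUnit km ∈ D ∧ SideTouch Λ (runPt zm (km + 1) t + cornerUnit km) (km + 3))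
    (hMidBox : ∀ t : ℕ, t ≤ h → ∀ z ∈ flatHalfBox km (runPt zm (km + 1) t) h (2 * h + 1), z ∈ D ∧ ∀ j : Fin 4, SideTouch Λ z j)
    -- the Harnack chain from the seed to the far sides
    {kH : ℕ} (hkH : 0 < kH) (cH : ℕ → Site 2) (J : ℕ)
    (hHbig : ∀ j, j ≤ J → ∀ z ∈ mW (cH j) kH, z ∈ D ∧ ∀ i : Fin 4, SideTouch Λ z i)
    (hHstep : ∀ j, j < J → cH (j + 1) ∈ mB (cH j) kH)
    (hHfar : ∀ t : ℕ, t ≤ h → ∀ z, nCoord km (runPt zm (km + 1) t) z = h + 1 →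
      |tCoord km (runPt zm (km + 1) t) z| ≤ 2 * h + 1 → ∃ j, j ≤ J ∧ z ∈ mB (cH j) kH)
    -- the seed at a deep frozen bond
    {a : Site 2} {k₀ j₀ : Fin 4} (ha : a ∉ Λ) (hk₀ : a + cornerUnit k₀ ∉ Λ) (hj₀ : j₀ = k₀ ∨ j₀ = k₀ + 3)
    {ρ R : ℕ} (hρR : 2 * beurlingConst * (((ρ : ℝ) + 1) / ((R : ℝ) + 1)) ^ beurlingExp ≤ 1)
    (hclosed : ∀ v ∈ D, (∀ j : Fin 4, SideTouch Λ v j) → ∀ m : Fin 4, v + cornerUnit m ∈ sqBox (faceAt a j₀) R → v + cornerUnit m ∈ D)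
    (hE : ∀ w ∈ D, w ∈ sqBox (faceAt a j₀) R → ∀ j : Fin 4, ¬ SideTouch Λ w j → gV (w + cornerOff j) = 1)
    (hc0D : cH 0 ∈ D) (hc0 : cH 0 ∈ sqBox (faceAt a j₀) ρ)
    -- the end runs
    {ι : Type*} (Ends : Finset ι) (cE aE : ι → Site 2) (kE jE τE : ι → Fin 4) (LE RE : ι → ℕ)
    (haE : ∀ e ∈ Ends, aE e ∉ Λ ∧ aE e + cornerUnit (kE e) ∉ Λ ∧ (jE e = kE e ∨ jE e = kE e + 3) ∧
      (cE e = faceAt (aE e) (jE e) ∨ (zdGraph 2).Adj (cE e) (faceAt (aE e) (jE e))))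
    (hLE : ∀ e ∈ Ends, 1 ≤ LE e ∧ 2 * LE e + 2 ≤ RE e)
    (hdeadE : ∀ e ∈ Ends, ∀ g ∈ D, g ∈ sqBox (cE e) (RE e) → ∀ j : Fin 4, ¬ SideTouch Λ g j → gV (g + cornerOff j) = 0)
    (hrunE : ∀ e ∈ Ends, ∀ n : ℤ, 0 ≤ n → n ≤ 2 * LE e → runPt (cE e) (τE e) n ∉ D)
    (hconeE : ∀ e ∈ Ends, ∀ i : ℕ, 8 ≤ i → i ≤ LE e → ∀ m : Fin 4, (m = τE e + 1 ∨ m = τE e + 3) →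
      ∀ z ∈ flatHalfBox m (runPt (cE e) (τE e) i) (i / 8) (i / 8), z ∈ D → ∀ j : Fin 4, SideTouch Λ z j)
    (hcarry : ∀ f ∈ D, ∀ j : Fin 4, SideTouch Λ f j → sideNbr f j ∉ D → ¬ Mid (sideNbr f j) →
      ∃ e ∈ Ends, ∃ i : ℕ, i ≤ LE e ∧ sideNbr f j = runPt (cE e) (τE e) i) :
    η * (modKappa * (maneuverConst / 2) ^ (J + 1) / 16) ≤
      Mb * (endRunConst * ∑ e ∈ Ends, ((((LE e : ℝ) + 1) / ((RE e : ℝ) + 1)) ^ endDecayExp)) := by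
  classical
  set V := kcModHM Λ D gV with hV
  have hV0 : ∀ x, 0 ≤ V x := kcModHM_nonneg Λ D hg0
  have hc0T : ∀ i : Fin 4, SideTouch Λ (cH 0) i := by
    have h0 : cH 0 ∈ mW (cH 0) kH := by
      simp only [mW, Set.mem_setOf_eq, sub_self, abs_zero]; constructor <;> positivity
    exact (hHbig 0 (Nat.zero_le J) _ h0).2
  have hseed : modKappa / 8 ≤ V (cH 0) := seed_lower_bound hΛ D hg0 ha hk₀ hj₀ hρR hclosed hE hc0D hc0T hc0
  set m₀ : ℝ := (maneuverConst / 2) ^ (J + 1) * (modKappa / 8) with hm₀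
  have hm₀0 : 0 ≤ m₀ := mul_nonneg (pow_nonneg (by linarith [maneuverConst_pos]) _) (by linarith [modKappa_pos])
  have hharmH : ∀ j, j ≤ J → IsLatticeHarmonicOn V (mW (cH j) kH) := fun j hj =>
    isLatticeHarmonicOn_kcModHM Λ D gV (hHbig j hj)
  have hfar : ∀ t : ℕ, t ≤ h → ∀ z, nCoord km (runPt zm (km + 1) t) z = h + 1 →
      |tCoord km (runPt zm (km + 1) t) z| ≤ 2 * h + 1 → m₀ ≤ V z := by
    intro t ht z hb htc
    have hz := hHfar t ht z hb htc
    calc m₀ ≤ (maneuverConst / 2) ^ (J + 1) * V (cH 0) :=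
          mul_le_mul_of_nonneg_left hseed (pow_nonneg (by linarith [maneuverConst_pos]) _)
      _ ≤ V z := harnack_chain_lower_bound hV0 hkH cH J hharmH hHstep hz
  have hmid : m₀ / 2 ≤ exitSum Λ D Flat V := half_le_exitSum_mid Λ D Flat hg0 km zm hh hm₀0 hFlatRun hMidBox hfar
  have hsplit := exitSum_split' Λ D gV u hg0 hsub hu0 Mid Flat hFlatMid hMid0 hFlat hRest
  have hrest : exitSum Λ D (fun g => ¬ Mid g) V ≤
      ∑ e ∈ Ends, endRunConst * ((((LE e : ℝ) + 1) / ((RE e : ℝ) + 1)) ^ endDecayExp) := by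
    refine (exitSum_rest_le_runs Λ D Mid hV0 Ends (fun e n => runPt (cE e) (τE e) n) LE hcarry).trans ?_
    refine Finset.sum_le_sum fun e he => ?_
    obtain ⟨ha', hk', hj', hc'⟩ := haE e he
    obtain ⟨hL', hLR'⟩ := hLE e he
    exact endRun_sum_le hΛ D hg0 hg1 ha' hk' hj' hc' (τE e) hL' hLR' (hdeadE e he) (hrunE e he) (hconeE e he)
  calc η * (modKappa * (maneuverConst / 2) ^ (J + 1) / 16) = η * (m₀ / 2) := by simp only [hm₀]; ring
    _ ≤ η * exitSum Λ D Flat V := mul_le_mul_of_nonneg_left hmid hη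
    _ ≤ Mb * exitSum Λ D (fun g => ¬ Mid g) V := hsplit
    _ ≤ Mb * ∑ e ∈ Ends, endRunConst * ((((LE e : ℝ) + 1) / ((RE e : ℝ) + 1)) ^ endDecayExp) :=
        mul_le_mul_of_nonneg_left hrest hMb
    _ = Mb * (endRunConst * ∑ e ∈ Ends, ((((LE e : ℝ) + 1) / ((RE e : ℝ) + 1)) ^ endDecayExp)) := by
        congr 1; rw [Finset.mul_sum]

end Literature.Probability.LatticeModels
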